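import Mathlib
import HarnessLib
import Summits.ResolutionOfSingularities.ResolutionOfSingularities.Theorems.WildQuotientsWildQuotientResolutionS1aExitAssembly

/-!
# BY-NAME closer of the registered stub `stub_exitAssembly` — line L `s1a-logminvertex`, crux stmt-ResolutionOfSingularities-17941

[OURS · L1 W4.5c · lead-1 g6] — NOT a statement of the manuscript; counted 0; AI-level work, weaker than expert
review. The registered skeleton `Cruxes/CyclicQuotientFourfolds/Lines/s1a_logminvertex.lean` (v3, sha16
fcedb56c70400326) carries the stub

`stub_exitAssembly : S1.LogExitPatching → ∀ p : ℕ, p.Prime → S1.GlobalKillOrExit p → S1.CyclicQuotientAt p`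

over the D2 vocabulary `…S1KillExitDefs` (p558072). Its content was PROVED in the tree by
`S1.ExitAssembly.stub_exitAssembly_holds` (`…S1aExitAssembly`, p563340: dimension `0` directly; `ρ` not faithful ⇒
`ρ = 1` since `|G| = p` is prime ⇒ `q` injective on points ⇒ birational, so the regular `X′` resolves `X₁`; `ρ`
faithful ⇒ unpack the KILL-or-EXIT model, `V/G → X₁` proper birational, `V/G` integral quasi-compact, apply
`LogExitPatching` to the zone and transfer the resolution along `V/G → X₁`). This file only restates that theorem
under the registered NAME and SIGNATURE, which is what closes the stub (plan-1 LEAD1-GEN6-BRIEF A1, BY-NAME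
CLOSURE RULE).
-/

-- single-problem summit: the doubled namespace component `ResolutionOfSingularities` is forced
set_option linter.dupNamespace false

noncomputable section

namespace Summit.ResolutionOfSingularities.ResolutionOfSingularities.Theorems.WildQuotientResolution.S1

/-- **Registered stub `stub_exitAssembly` of line `s1a-logminvertex` (crux `CyclicQuotientFourfolds`,
stmt-ResolutionOfSingularities-17941), signature VERBATIM**: the consumer brick `S1.LogExitPatching` and a global
KILL-or-EXIT model at the prime `p` give the crux statement at `p`. Proof = `S1.ExitAssembly.stub_exitAssembly_holds`.
[OURS · L1 W4.5c] — NOT a statement of the manuscript. -/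
theorem stub_exitAssembly :
    S1.LogExitPatching → ∀ p : ℕ, p.Prime → S1.GlobalKillOrExit p → S1.CyclicQuotientAt p :=
  ExitAssembly.stub_exitAssembly_holds

end Summit.ResolutionOfSingularities.ResolutionOfSingularities.Theorems.WildQuotientResolution.S1

end
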